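import Summits.BirchSwinnertonDyer.BirchSwinnertonDyer.Theses.SmallImageMuTransfer
import Literature.NumberTheory.GaloisCohomology.PoitouTateNumberField
import HarnessLib

/-!
# Item `PoitouTateSumLocalPairingsRat` of route `SmallImageMuTransfer` (stmt-BirchSwinnertonDyer-19845) —
# CLOSED: F3 = Poitou–Tate over `ℚ` is a tree theorem

Cell `b2b-bsdres`, unit `b2b-bsdres-x10` (= N2 class lead, GEN 40), for the `bsd-smallim` cell's rung-K6
route.  HONEST FRAMING (run/shared/lean/b2b/bsd-rank1-residual/, verbatim in every file): the goal of
the cell is to DELETE the COMBINATION-SHAPED residual classes of the Birch–Swinnerton-Dyer formula for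
analytic-rank `≤ 1` curves over `ℚ` using PUBLISHED theorems only, and to TYPE the CONSTRUCTION-SHAPED
remainder; this is not "finishing BSD".  One closing theorem, no definition, no named fact, no `sorry`;
it closes an ASIDE item (the by-name alias of hypothesis F3 of `MuTransferX9Core`), never summit credit,
and proves no case of BSD.  PARTITION (D-0054): X9 (A4; good-ordinary `p ∈ {5, 7}`, `ρ̄` irreducible ∧
¬surjective) + X10b∧¬Surj (A5) × `p = 3` — closes the aside item 19845 only.

`PoitouTateSumLocalPairingsRat := GaloisCohomology.poitouTate_sum_localTatePairing_eq_zero ℚ` (the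
Poitou–Tate sum formula over `ℚ`: for a finite Galois module `M` and global classes the local Tate pairings
sum to zero; Milne ADT I Thm. 4.10 (b), Tate in Cassels–Fröhlich VII §11, NSW (8.6.10)).  Since
2026-08-26T23:39Z this named fact is DISCHARGED for every number field by cell `bsd-cn100`
(`Literature/NumberTheory/GaloisCohomology/PoitouTateNumberField.lean`, p475389):
`GaloisCohomology.poitouTate_sum_localTatePairing_eq_zero_holds : ∀ (F : Type) [Field F] [NumberField F],
poitouTate_sum_localTatePairing_eq_zero F`.  The item is its instance at `F = ℚ`.  Consequence for the
deciding crux `MuTransferX9` (stmt 19276, open by design): its open surface is F1 (Kato Thm. 12.5/12.6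
package, aside 19843) ∧ F2 (Kato §13.8, aside 19844) — F3 is gone.

References: J. S. Milne, *Arithmetic Duality Theorems*, 2nd ed. (2006), Ch. I Thm. 4.10 (b) [MilneADT2006];
J. Tate, Ch. VII of Cassels–Fröhlich (1967), §11 [CasselsFrohlichANT1967]; Neukirch–Schmidt–Wingberg (2008)
(8.6.10) [NeukirchSchmidtWingberg2008].
-/

-- the summit and its single problem are both named `BirchSwinnertonDyer` (registry layout D-0017)
set_option linter.dupNamespace false
set_option autoImplicit false

namespace Summit.BirchSwinnertonDyer.BirchSwinnertonDyer.Theorems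

/-- **Item `PoitouTateSumLocalPairingsRat` (stmt-BirchSwinnertonDyer-19845), literally the route decl —
PROVED**: the Poitou–Tate sum formula over `ℚ` (hypothesis F3 of `MuTransferX9Core`), by the tree theorem
`GaloisCohomology.poitouTate_sum_localTatePairing_eq_zero_holds` (every number field) at `F = ℚ`.
[cite: MilneADT2006, Ch. I, Thm. 4.10(b)] [cite: CasselsFrohlichANT1967, Ch. VII §11] -/
theorem smallImageMuTransfer_PoitouTateSumLocalPairingsRat_proof :
    Summit.BirchSwinnertonDyer.BirchSwinnertonDyer.Theses.SmallImageMuTransfer.PoitouTateSumLocalPairingsRat := by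
  unfold Summit.BirchSwinnertonDyer.BirchSwinnertonDyer.Theses.SmallImageMuTransfer.PoitouTateSumLocalPairingsRat
  exact Literature.NumberTheory.GaloisCohomology.poitouTate_sum_localTatePairing_eq_zero_holds ℚ

end Summit.BirchSwinnertonDyer.BirchSwinnertonDyer.Theorems
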